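import Mathlib
import Literature.AlgebraicGeometry.Tropical.InitialIdeal
import Literature.AlgebraicGeometry.Tropical.SchonIdeal
import Summits.ResolutionOfSingularities.ResolutionOfSingularities.Theorems.TropicalLinksInductiveStepWeightZero
import Summits.ResolutionOfSingularities.ResolutionOfSingularities.Theorems.TropicalLinksInductiveStepSchonAtZero
import Summits.ResolutionOfSingularities.ResolutionOfSingularities.Theorems.TropicalLinksInductiveStepLaurentRegular

/-!
# TropicalLinks / InductiveStep — Laurent polynomial rings in several variables are regular iff the
# base is; the torus is schön (Gröbner dictionary, brick B7m)

Route `ResolutionOfSingularities/TropicalLinks`, crux `InductiveStep` (stmt-ResolutionOfSingularities-17233),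
line `split`, in support of stub `stub_sncClosureSchon`.  Brick B7
(`TropicalLinksInductiveStepLaurentRegular.lean`) treats one Laurent variable; the local toric
computation at the end of the roadmap for `stub_sncClosureSchon` (the special fibre of the partial
compactification along a ray through an snc stratum of codimension `r` is `𝔾_m^{r-1} ×` the stratum)
needs several:

* `tropicalLinks_forall_prime_regular_laurent_pi_iff` (registered brick B7m) — for a Noetherian ring
  `A` and `m : ℕ`, every prime localization of `A[ℤ^m] = AddMonoidAlgebra A (Fin m → ℤ)` is regular iff
  the same holds for `A` (induction on `m` through `A[ℤ^{m+1}] ≃+* (A[ℤ^m])[ℤ]`);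
* `tropicalLinks_forall_prime_regular_laurent_field` — over a field, `k[ℤ^n]` is regular at every prime;
* `tropicalLinks_isSchonIdeal_bot` (registered) — **the torus `𝔾_m^n = V(0)` is schön**: every initial
  ideal of `(0)` is `(0)` (Tevelev 2007, §1: the first example of a schön very affine variety).

No new definitions.
-/

-- single-problem summit: the doubled namespace component `ResolutionOfSingularities` is forced
set_option linter.dupNamespace false

namespace Summit.ResolutionOfSingularities.ResolutionOfSingularities.Theorems

open AddMonoidAlgebra Literature.AlgebraicGeometry.Tropical

/-- **`A[ℤ^m]` is regular at every prime iff `A` is** (Noetherian `A`), by induction on `m` via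
`A[ℤ^{m+1}] ≃+* (A[ℤ^m])[ℤ]` and the one-variable brick B7. [folklore] -/
theorem tropicalLinks_forall_prime_regular_laurent_pi_iff :
    ∀ (A : Type) [CommRing A] (m : ℕ), IsNoetherianRing A → ((∀ (P : Ideal (AddMonoidAlgebra A (Fin m → ℤ))) [P.IsPrime], IsRegularLocalRing (Localization.AtPrime P)) ↔ ∀ (P : Ideal A) [P.IsPrime], IsRegularLocalRing (Localization.AtPrime P)) := by
  intro A _ m hA
  induction m with
  | zero =>
    have e : AddMonoidAlgebra A (Fin 0 → ℤ) ≃+* A := AddMonoidAlgebra.uniqueRingEquiv (Fin 0 → ℤ)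
    exact ⟨fun h => tropicalLinks_forall_prime_regular_of_ringEquiv e h,
      fun h => tropicalLinks_forall_prime_regular_of_ringEquiv e.symm h⟩
  | succ m ih =>
    -- `A[ℤ^{m+1}] ≃+* (A[ℤ^m])[ℤ]` by splitting off the first coordinate and currying
    let eL : (Fin (m + 1) → ℤ) ≃+ ℤ × (Fin m → ℤ) :=
      { (Fin.consEquiv fun _ : Fin (m + 1) => ℤ).symm with map_add' := fun _ _ => rfl }
    have E : AddMonoidAlgebra A (Fin (m + 1) → ℤ) ≃+*
        AddMonoidAlgebra (AddMonoidAlgebra A (Fin m → ℤ)) ℤ :=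
      (AddMonoidAlgebra.domCongr A A eL).toRingEquiv.trans AddMonoidAlgebra.curryRingEquiv
    haveI : IsNoetherianRing (AddMonoidAlgebra A (Fin (m + 1) → ℤ)) :=
      Algebra.FiniteType.isNoetherianRing A _
    have hN : IsNoetherianRing (AddMonoidAlgebra (AddMonoidAlgebra A (Fin m → ℤ)) ℤ) :=
      isNoetherianRing_of_ringEquiv _ E
    rw [← ih, ← tropicalLinks_forall_prime_regular_laurent_iff _ hN]
    exact ⟨fun h => tropicalLinks_forall_prime_regular_of_ringEquiv E h,
      fun h => tropicalLinks_forall_prime_regular_of_ringEquiv E.symm h⟩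

/-- Over a field, the Laurent polynomial ring `k[ℤ^n]` (the torus `𝔾_m^n`) is regular at every prime.
[folklore] -/
theorem tropicalLinks_forall_prime_regular_laurent_field (k : Type) [Field k] (n : ℕ) :
    ∀ (P : Ideal (AddMonoidAlgebra k (Fin n → ℤ))) [P.IsPrime],
      IsRegularLocalRing (Localization.AtPrime P) :=
  (tropicalLinks_forall_prime_regular_laurent_pi_iff k n inferInstance).2
    (tropicalLinks_forall_prime_regular_of_isField (Field.toIsField k))

/-- **The torus is schön**: the zero ideal of `k[ℤ^n]` is a schön ideal — every initial ideal of `(0)`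
is `(0)` and `k[ℤ^n]` is regular. [folklore] -/
theorem tropicalLinks_isSchonIdeal_bot :
    ∀ (k : Type) [Field k] (n : ℕ), Literature.AlgebraicGeometry.Tropical.IsSchonIdeal (⊥ : Ideal (AddMonoidAlgebra k (Fin n → ℤ))) := by
  intro k _ n w
  have h : weightInitialIdeal w (⊥ : Ideal (AddMonoidAlgebra k (Fin n → ℤ))) = ⊥ := initialIdeal_bot _
  rw [tropicalLinks_forall_prime_regular_congr h]
  exact tropicalLinks_forall_prime_regular_of_ringEquiv
    (RingEquiv.quotientBot (AddMonoidAlgebra k (Fin n → ℤ))).symm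
    (tropicalLinks_forall_prime_regular_laurent_field k n)

end Summit.ResolutionOfSingularities.ResolutionOfSingularities.Theorems
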